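import Literature.Analysis.FluidPDE.DeRosaGluedVelocity
import Literature.Analysis.FluidPDE.DeRosaTimeRegularityProofs
import Literature.Analysis.FunctionSpaces.TorusSpaceTimeCutoff
import HarnessLib

/-!
# De Rosa's gluing stage, Prop. 5.5: the energy estimate (5.18) with the dissipative term

L. De Rosa, *Infinitely many Leray–Hopf solutions for the fractional Navier–Stokes equations*,
Comm. PDE 44 (2019) 335–365 = arXiv:1801.10235, §5.2, Prop. 5.5, (5.18):
"`|∫|v̄_q|² - |v_ℓ|²| ≲ δ_{q+1}ℓ^α` … we prove explicitly (5.18) since it involves the structure of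
the dissipative term": with `|v̄_q|² - |v_ℓ|² = χᵢ(|vᵢ|² - |v_ℓ|²) + (1-χᵢ)(|vᵢ₊₁|² - |v_ℓ|²) - χᵢ(1-χᵢ)|vᵢ - vᵢ₊₁|²`
and "`|d/dt ∫(|vᵢ|² - |v_ℓ|²)| = 2|∫∇v_ℓ : R̊_ℓ| + 2ν|∫(|(-Δ)^{γ/2}vᵢ|² - |(-Δ)^{γ/2}v_ℓ|²)|`",
"`|∫∇v_ℓ : R̊_ℓ| ≲ δ_q^{1/2}λ_qδ_{q+1} ≲ τ_q⁻¹δ_{q+1}ℓ^α`", and "since `‖v_q‖_γ' ≤ 1` for every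
`γ' < β` …, by (5.10), Theorem 7.1 and Cauchy–Schwarz,
`|∫(|(-Δ)^{γ/2}vᵢ|² - |(-Δ)^{γ/2}v_ℓ|²)| ≲ ‖vᵢ - v_ℓ‖_{γ+α} ≲ τ_qδ_{q+1}ℓ^{-1-γ} ≲ τ_q⁻¹δ_{q+1}ℓ^α`,
where in the last inequality (remember the restriction `γ < 1/3`) we have used
`ℓ^{-1-γ} ≤ ℓ^{-4/3} ≤ τ_q^{-2}ℓ^α`. Moreover `vᵢ = v_ℓ` for `t = tᵢ`. Therefore, after integrating
in time, `|∫|vᵢ|² - |v_ℓ|²| ≲ δ_{q+1}ℓ^α`" (p. 14).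

This file proves the analytic content of this argument for a `DeRosa.IsGlueFamily`
(`DeRosaGluedTriple.lean`):

* `Torus.fracLaplacian_fracLaplacian` — the semigroup law `(-Δ)^s (-Δ)^t a = (-Δ)^{s+t} a` on smooth
  fields (Fourier multipliers);
* `Torus.exists_abs_dissipation_sub_le_of_holder` — **the dissipative difference**:
  `|∫⟪(-Δ)^γ a, a⟫ - ∫⟪(-Δ)^γ b, b⟫| = |∫⟪(-Δ)^{γ/2}(a+b), (-Δ)^{γ/2}(a-b)⟫| ≤ C [a+b]_θ [a-b]_θ` for
  `γ < θ ≤ 1` (Thm. 7.1 with `β = 0` at exponent `γ/2`, `FracLaplacianHolder.lean`), the Lean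
  form of "Theorem 7.1 and Cauchy–Schwarz" (only a Hölder exponent *above `γ`* is needed);
* `Torus.holder_lift_of_holderWith`, `Torus.holder_lift_interpolate` — the Hölder data in the
  lifted form used by Thm. 7.1, from `HolderWith` and from a sup/derivative pair (interpolation
  `[w]_θ ≤ (2‖w‖₀)^{1-θ}[w]₁^θ`, BDSV (A.3));
* `DeRosa.IsGlueFamily.abs_energy_v_sub_le` — **the energy of an exact solution stays close to
  that of the mollified triple**: `|∫|uᵢ(t)|² - ∫|v_ℓ(t)|²| ≤ (6 B_R B_v + 2|ν| K) · 2τ` on the life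
  span of `uᵢ`, where `B_R`, `B_v` bound `|R̊_ℓ|`, `|∇v_ℓ|` and `K` bounds the dissipative
  difference (the energy balance of `Torus.IsFracNSReynoldsOn`, `FracNSEnergy.lean`, for both,
  equality at the left anchor, and `0 ≤ t - anchor ≤ 2τ`);
* `DeRosa.IsGlueFamily.dissipation_sub_le` — the dissipative difference along the family is at
  most `C (2C_H + B) B` when the slices of `v_ℓ` are `θ`-Hölder with constant `C_H` and `uᵢ - v_ℓ`
  obeys the lifted `θ`-Hölder bound with constant `B`;
* `DeRosa.IsGlueFamily.holder_lift_velocity_sub` — that constant from the stability bounds (5.10)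
  at orders `0, 1`: `B = 3|C₃| τ_q δ_{q+1} ℓ^{-1-θ+α}` (De Rosa's "`‖vᵢ - v_ℓ‖_{γ+α} ≲ τ_qδ_{q+1}ℓ^{-1-γ}`");
* `DeRosa.IsGlueFamily.abs_energy_gluedVel_sub_le` — **(5.18) up to the dissipative constant**: for
  the glued velocity of a De Rosa family with the stability bounds (constant `C₃`), the inductive
  bounds (5.6)₀ on `v_ℓ`, (5.7′)₀ on `R̊_ℓ` (constant `C_in 0`) and a bound `K` for the dissipative
  differences on the life spans,
  `|∫|v̄(t)|² - ∫|v_ℓ(t)|²| ≤ (12 C_in(0)² + 4 C₃²) δ_{q+1} ℓ^α + 4|ν| K τ_q` (BDSV Prop. 4.4 with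
  life spans of length `2τ_q` and the extra term). With `K = C(2C_H + B)B` and
  `B = 3|C₃|τ_qδ_{q+1}ℓ^{-1-θ+α}`, the last term is `≲ δ_{q+1}ℓ^α` as soon as
  `τ_q² ℓ^{-1-θ} ≤ 1` and `B ≤ 1` — De Rosa's "`ℓ^{-1-γ} ≤ ℓ^{-4/3} ≤ τ_q^{-2}ℓ^α`" (valid for
  `θ < 1/3`, `b < (1-β)/(2β)`) and "`‖v_q‖_γ' ≤ 1`" (valid for `θ < β`) — two parameter inequalities
  discharged where the thresholds `α₀`, `a₀` are chosen (the assembly of Prop. 5.5).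

## References

* L. De Rosa, Comm. PDE 44 (2019) = arXiv:1801.10235, §5.2 Prop. 5.5, proof of (5.18) (p. 14);
  §7 Thm. 7.1. [`Derosa2018`]
* T. Buckmaster, C. De Lellis, L. Székelyhidi Jr., V. Vicol, CPAM 72 (2019) = arXiv:1701.08678,
  Prop. 4.4 and App. A (A.3). [`BuckmasterEtAl2018`]
-/

noncomputable section

open MeasureTheory Set Filter Topology Function
open scoped NNReal ENNReal ContDiff InnerProductSpace

namespace Literature.Analysis.FluidPDE

/-! ## The dissipative difference -/

namespace Torus

open FunctionSpaces FunctionSpaces.Torus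

variable {d : Type*} [Fintype d] [DecidableEq d]

omit [DecidableEq d] in
/-- The symbol is multiplicative in the exponent: `σ_{s+t}(k) = σ_s(k) σ_t(k)` for `s, t ≥ 0`. [folklore] -/
theorem fracSymbol_add {s t : ℝ} (hs : 0 ≤ s) (ht : 0 ≤ t) (k : d → ℤ) :
    fracSymbol (s + t) k = fracSymbol s k * fracSymbol t k := by
  unfold fracSymbol
  exact Real.rpow_add_of_nonneg (by have := FunctionSpaces.Torus.freqNormSq_nonneg k; positivity) hs ht

/-- **Semigroup law of the fractional Laplacian on smooth fields**: `(-Δ)^s ((-Δ)^t a) = (-Δ)^{s+t} a`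
for `s, t ≥ 0` (the Fourier coefficients of `(-Δ)^t a` are `σ_t(k) â(k)`,
`Torus.mFourierCoeff_complexify_fracLaplacian`, and `σ_s σ_t = σ_{s+t}`). [folklore] -/
theorem fracLaplacian_fracLaplacian {s t : ℝ} (hs : 0 ≤ s) (ht : 0 ≤ t)
    {a : UnitAddTorus d → EuclideanSpace ℝ d} (ha : IsSmooth a) :
    fracLaplacian s (fracLaplacian t a) = fracLaplacian (s + t) a := by
  funext x
  rw [fracLaplacian_def, fracLaplacian_def]
  congr 1
  refine tsum_congr fun k => ?_
  rw [mFourierCoeff_complexify_fracLaplacian ht ha k, fracSymbol_smul_mFourier_smul,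
    fracSymbol_smul_mFourier_smul, fracSymbol_add hs ht k, Complex.ofReal_mul, mul_smul]

omit [DecidableEq d] in
/-- `|∫⟪F, G⟫| ≤ (sup‖F‖)(sup‖G‖)` on the unit torus (volume one). [folklore] -/
theorem abs_integral_inner_le_mul_of_norm_le {F G : UnitAddTorus d → EuclideanSpace ℝ d} {A B : ℝ}
    (hA : 0 ≤ A) (hF : ∀ x, ‖F x‖ ≤ A) (hG : ∀ x, ‖G x‖ ≤ B) :
    |∫ x, ⟪F x, G x⟫_ℝ| ≤ A * B := by
  have hpt : ∀ x, |⟪F x, G x⟫_ℝ| ≤ A * B := fun x =>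
    (abs_real_inner_le_norm _ _).trans (mul_le_mul (hF x) (hG x) (norm_nonneg _) hA)
  refine (abs_integral_le_integral_abs).trans ?_
  calc ∫ x, |⟪F x, G x⟫_ℝ| ≤ ∫ _x : UnitAddTorus d, A * B :=
        integral_mono_of_nonneg (Eventually.of_forall fun x => abs_nonneg _) (integrable_const _)
          (Eventually.of_forall hpt)
    _ = A * B := by simp

/-- **The dissipative difference is controlled by Hölder seminorms of `a ± b` above `γ`** (De Rosa,
proof of (5.18): "`|∫(|(-Δ)^{γ/2}vᵢ|² - |(-Δ)^{γ/2}v_ℓ|²)| ≲ ‖vᵢ - v_ℓ‖_{γ+α}`" using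
"`‖v_q‖_γ' ≤ 1`", Theorem 7.1 and Cauchy–Schwarz): for `0 < γ < θ ≤ 1` there is
`C = C(γ, θ, d)` such that for smooth `a, b : 𝕋^d → ℝ^d` with
`‖(a+b)(proj y) - (a+b)(proj z)‖ ≤ A‖y - z‖^θ` and `‖(a-b)(proj y) - (a-b)(proj z)‖ ≤ B‖y - z‖^θ`:
`|∫⟪(-Δ)^γ a, a⟫ - ∫⟪(-Δ)^γ b, b⟫| ≤ C A B`. Indeed the difference is
`∫⟪(-Δ)^γ(a+b), a-b⟫ = ∫⟪(-Δ)^{γ/2}(a+b), (-Δ)^{γ/2}(a-b)⟫` (semigroup law and symmetry), and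
`‖(-Δ)^{γ/2}u‖₀ ≤ C₁[u]_θ` for `θ > γ` (Thm. 7.1 with `β = 0`). [cite: Derosa2018, §5.2 Prop. 5.5 (proof of (5.18)) and §7 Thm. 7.1] -/
theorem exists_abs_dissipation_sub_le_of_holder (d : Type*) [Fintype d] [DecidableEq d]
    {γ : ℝ} (hγ0 : 0 < γ) {θ : ℝ} (hθ : γ < θ) (hθ1 : θ ≤ 1) :
    ∃ C : ℝ, 0 ≤ C ∧ ∀ {a b : UnitAddTorus d → EuclideanSpace ℝ d}, IsSmooth a → IsSmooth b →
      ∀ {A : ℝ}, 0 ≤ A →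
        (∀ y z : EuclideanSpace ℝ d, ‖(a (proj y) + b (proj y)) - (a (proj z) + b (proj z))‖ ≤
          A * ‖y - z‖ ^ θ) →
        ∀ {B : ℝ}, 0 ≤ B →
          (∀ y z : EuclideanSpace ℝ d, ‖(a (proj y) - b (proj y)) - (a (proj z) - b (proj z))‖ ≤
            B * ‖y - z‖ ^ θ) →
          |(∫ x, ⟪fracLaplacian γ a x, a x⟫_ℝ) - ∫ x, ⟪fracLaplacian γ b x, b x⟫_ℝ| ≤ C * A * B := by
  have hg0 : 0 < γ / 2 := by linarith
  have hg1 : γ / 2 < 1 := by linarith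
  have hgθ : 2 * (γ / 2) < θ := by linarith
  obtain ⟨C₁, hC₁0, hC₁⟩ := exists_norm_fracLaplacian_le_of_holder d hg0 hg1 hgθ hθ1
  refine ⟨C₁ * C₁, mul_nonneg hC₁0 hC₁0, ?_⟩
  intro a b ha hb A hA hHA B hB hHB
  have hp : IsSmooth (fun x => a x + b x) := ha.add hb
  have hm : IsSmooth (fun x => a x - b x) := ha.sub hb
  rw [integral_inner_fracLaplacian_self_sub hγ0.le ha hb]
  -- `(-Δ)^γ (a+b) = (-Δ)^{γ/2} ((-Δ)^{γ/2} (a+b))`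
  have hsemi : fracLaplacian γ (fun x => a x + b x) =
      fracLaplacian (γ / 2) (fracLaplacian (γ / 2) (fun x => a x + b x)) := by
    rw [fracLaplacian_fracLaplacian hg0.le hg0.le hp, add_halves]
  have hF : IsSmooth (fracLaplacian (γ / 2) (fun x => a x + b x)) := hp.fracLaplacian hg0.le
  rw [hsemi, integral_inner_fracLaplacian_comm hg0.le hF hm]
  have hFb : ∀ x, ‖fracLaplacian (γ / 2) (fun y => a y + b y) x‖ ≤ C₁ * A := hC₁ hp hA hHA
  have hGb : ∀ x, ‖fracLaplacian (γ / 2) (fun y => a y - b y) x‖ ≤ C₁ * B := hC₁ hm hB hHB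
  calc |∫ x, ⟪fracLaplacian (γ / 2) (fun y => a y + b y) x, fracLaplacian (γ / 2) (fun y => a y - b y) x⟫_ℝ|
      ≤ (C₁ * A) * (C₁ * B) := abs_integral_inner_le_mul_of_norm_le (mul_nonneg hC₁0 hA) hFb hGb
    _ = C₁ * C₁ * A * B := by ring

/-! ## Hölder data in lifted form -/

omit [DecidableEq d] in
/-- A `HolderWith` bound for the quotient metric of `𝕋^d` gives the lifted bound
`‖f(proj y) - f(proj z)‖ ≤ C‖y - z‖^r` (`proj` is `1`-Lipschitz). [folklore] -/
theorem holder_lift_of_holderWith {Y : Type*} [NormedAddCommGroup Y] {f : UnitAddTorus d → Y}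
    {C r : ℝ≥0} (hf : HolderWith C r f) (y z : EuclideanSpace ℝ d) :
    ‖f (proj y) - f (proj z)‖ ≤ C * ‖y - z‖ ^ (r : ℝ) := by
  have h1 := hf.dist_le (proj y) (proj z)
  rw [dist_eq_norm] at h1
  refine h1.trans (mul_le_mul_of_nonneg_left ?_ C.coe_nonneg)
  exact Real.rpow_le_rpow dist_nonneg (dist_proj_proj_le y z) r.coe_nonneg

/-- **Interpolated Hölder bound in lifted form** (BDSV (A.3), `[w]_θ ≲ ‖w‖₀^{1-θ}[w]₁^θ`): if
`‖w x‖ ≤ X₀` and `‖∂ⱼw x‖ ≤ X₁` for all `x, j` (`w ∈ C¹`, `X₁ ≥ 0`), then for `θ ∈ [0,1]`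
`‖w(proj y) - w(proj z)‖ ≤ (2X₀)^{1-θ} (#d · X₁)^θ ‖y - z‖^θ`. [cite: BuckmasterEtAl2018, App. A (A.3)] -/
theorem holder_lift_interpolate {Y : Type*} [NormedAddCommGroup Y] [NormedSpace ℝ Y]
    {w : UnitAddTorus d → Y} (hw : IsContDiff 1 w) {X₀ X₁ θ : ℝ} (hX₁ : 0 ≤ X₁) (h0 : ∀ x, ‖w x‖ ≤ X₀)
    (h1 : ∀ j x, ‖FunctionSpaces.Torus.partialDeriv j w x‖ ≤ X₁) (hθ0 : 0 ≤ θ) (hθ1 : θ ≤ 1)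
    (y z : EuclideanSpace ℝ d) :
    ‖w (proj y) - w (proj z)‖ ≤ (2 * X₀) ^ (1 - θ) * (Fintype.card d * X₁) ^ θ * ‖y - z‖ ^ θ := by
  have hX₀ : 0 ≤ X₀ := (norm_nonneg _).trans (h0 (proj y))
  -- Lipschitz bound on the lift
  have hlip : ‖w (proj y) - w (proj z)‖ ≤ (Fintype.card d * X₁) * ‖y - z‖ := by
    have hfd : ∀ u : EuclideanSpace ℝ d, ‖fderiv ℝ (lift w) u‖ ≤ ∑ _j : d, X₁ := fun u =>
      norm_fderiv_lift_le_of_norm_partialDeriv_le hw (M := fun _ => X₁) (fun j x => h1 j x) u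
    have hdiff : Differentiable ℝ (lift w) := ContDiff.differentiable hw (by simp)
    have hmv := (convex_univ).norm_image_sub_le_of_norm_fderiv_le (fun u _ => hdiff u)
      (fun u _ => hfd u) (mem_univ z) (mem_univ y)
    rw [Finset.sum_const, Finset.card_univ, nsmul_eq_mul] at hmv
    simpa [lift] using hmv
  have hsup : ‖w (proj y) - w (proj z)‖ ≤ 2 * X₀ :=
    (norm_sub_le _ _).trans (by linarith [h0 (proj y), h0 (proj z)])
  calc ‖w (proj y) - w (proj z)‖ ≤ min (2 * X₀) ((Fintype.card d * X₁) * ‖y - z‖) := le_min hsup hlip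
    _ ≤ (2 * X₀) ^ (1 - θ) * ((Fintype.card d * X₁) * ‖y - z‖) ^ θ :=
        BDSV.min_le_rpow_mul_rpow (by positivity) (by positivity) hθ0 hθ1
    _ = (2 * X₀) ^ (1 - θ) * (Fintype.card d * X₁) ^ θ * ‖y - z‖ ^ θ := by
        rw [Real.mul_rpow (by positivity) (norm_nonneg _)]; ring

end Torus

/-! ## The energy of one exact solution -/

namespace DeRosa

open FunctionSpaces FunctionSpaces.Torus
open BDSV hiding IsGlueFamily

section Energy

variable {γ ν β α a b T C₃ : ℝ} {q n Nb : ℕ} {vℓ : ℝ → UnitAddTorus (Fin 3) → EuclideanSpace ℝ (Fin 3)} {pℓ : ℝ → UnitAddTorus (Fin 3) → ℝ}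
  {Rℓ : ℝ → UnitAddTorus (Fin 3) → Fin 3 → EuclideanSpace ℝ (Fin 3)} {v : ℕ → ℝ → UnitAddTorus (Fin 3) → EuclideanSpace ℝ (Fin 3)} {p : ℕ → ℝ → UnitAddTorus (Fin 3) → ℝ} {Cin : ℕ → ℝ}

/-- **The energy of an exact solution stays close to that of the mollified triple** (De Rosa,
proof of (5.18): "`|d/dt∫(|vᵢ|² - |v_ℓ|²)| = 2|∫∇v_ℓ : R̊_ℓ| + 2ν|∫(|(-Δ)^{γ/2}vᵢ|² - |(-Δ)^{γ/2}v_ℓ|²)|`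
… Moreover `vᵢ = v_ℓ` for `t = tᵢ`. Therefore, after integrating in time …"):
`|∫|uᵢ(t)|² - ∫|v_ℓ(t)|²| ≤ (6 B_R B_v + 2|ν| K) · 2τ` on the life span `Sᵢ` (`i ≤ n`), where `B_R`
bounds `|R̊_ℓ|`, `B_v` bounds `|∇v_ℓ|` on `[0,T] × 𝕋³` and `K` bounds the dissipative difference
`|∫⟪(-Δ)^γuᵢ, uᵢ⟫ - ∫⟪(-Δ)^γv_ℓ, v_ℓ⟫|` on `Sᵢ`: both energies are differentiable on `Sᵢ`
(`Torus.IsFracNSReynoldsOn.hasDerivWithinAt_energy`), agree at the left endpoint of `Sᵢ`, and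
`Sᵢ` has length `≤ 2τ`. [cite: Derosa2018, §5.2 Prop. 5.5 (proof of (5.18))] -/
theorem IsGlueFamily.abs_energy_v_sub_le {τ : ℝ} (h : IsGlueFamily γ ν T τ n vℓ pℓ Rℓ v p) {i : ℕ}
    (hi : i ≤ n) {BR Bv K : ℝ} (hBR : 0 ≤ BR)
    (hR : ∀ s ∈ Icc 0 T, ∀ x j, ‖Rℓ s x j‖ ≤ BR)
    (hDv : ∀ s ∈ Icc 0 T, ∀ x j, ‖FunctionSpaces.Torus.partialDeriv j (vℓ s) x‖ ≤ Bv)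
    (hKb : ∀ s ∈ glueInterval T τ i,
      |(∫ x, ⟪Torus.fracLaplacian γ (v i s) x, v i s x⟫_ℝ) - ∫ x, ⟪Torus.fracLaplacian γ (vℓ s) x, vℓ s x⟫_ℝ| ≤ K)
    {t : ℝ} (ht : t ∈ glueInterval T τ i) :
    |(∫ x, ‖v i t x‖ ^ 2) - ∫ x, ‖vℓ t x‖ ^ 2| ≤ (6 * BR * Bv + 2 * |ν| * K) * (2 * τ) := by
  have hτ := h.hτ
  have hiT := h.anchor_le hi
  set a' := max ((i : ℝ) * τ - τ) 0 with ha'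
  set b' := min ((i : ℝ) * τ + τ) T with hb'
  have hS : glueInterval T τ i = Icc a' b' := glueInterval_eq_Icc T τ i
  have hi0 : 0 ≤ (i : ℝ) * τ := by positivity
  have hab : a' < b' := by
    simp only [ha', hb', max_lt_iff, lt_min_iff]
    refine ⟨⟨by linarith, by linarith⟩, by linarith, h.hT⟩
  have hsub : Icc a' b' ⊆ Icc 0 T := by rw [← hS]; exact glueInterval_subset_Icc T τ i
  have ht' : t ∈ Icc a' b' := by rwa [hS] at ht
  have hanchor : a' ∈ Icc a' b' := ⟨le_rfl, hab.le⟩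
  -- the two fractional NSR structures on `[a', b']`
  have hexI : Torus.IsFracNSReynoldsOn (Icc a' b') γ ν (v i) (p i) (fun _ _ _ => 0) := by
    have := h.exact i hiT
    rwa [hS] at this
  have hℓI : Torus.IsFracNSReynoldsOn (Icc a' b') γ ν vℓ pℓ Rℓ := h.nsr.mono hsub (uniqueDiffOn_Icc hab)
  -- the difference of the energies and its derivative
  set F : ℝ → ℝ := fun s => (∫ x, ‖v i s x‖ ^ 2) - ∫ x, ‖vℓ s x‖ ^ 2 with hF
  set F' : ℝ → ℝ := fun s =>
    ((-2 * ∫ x, ∑ j, ⟪(0 : EuclideanSpace ℝ (Fin 3)), FunctionSpaces.Torus.partialDeriv j (v i s) x⟫_ℝ) -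
        2 * ν * ∫ x, ⟪Torus.fracLaplacian γ (v i s) x, v i s x⟫_ℝ) -
      ((-2 * ∫ x, ∑ j, ⟪Rℓ s x j, FunctionSpaces.Torus.partialDeriv j (vℓ s) x⟫_ℝ) -
        2 * ν * ∫ x, ⟪Torus.fracLaplacian γ (vℓ s) x, vℓ s x⟫_ℝ) with hF'
  have hderiv : ∀ s ∈ Icc a' b', HasDerivWithinAt F (F' s) (Icc a' b') s := fun s hs =>
    (hexI.hasDerivWithinAt_energy hab h.hγ.le hs).sub (hℓI.hasDerivWithinAt_energy hab h.hγ.le hs)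
  have hbound : ∀ s ∈ Icc a' b', ‖F' s‖ ≤ 6 * BR * Bv + 2 * |ν| * K := by
    intro s hs
    have h0 : (-2 * ∫ x, ∑ j, ⟪(0 : EuclideanSpace ℝ (Fin 3)), FunctionSpaces.Torus.partialDeriv j (v i s) x⟫_ℝ) = 0 := by
      simp
    have h1 := Torus.abs_energyRate_le (v := vℓ) (R := Rℓ) (t := s) hBR (hR s (hsub hs)) (hDv s (hsub hs))
    rw [Fintype.card_fin] at h1
    have h2 := hKb s (by rw [hS]; exact hs)
    have e : F' s = -(-2 * ∫ x, ∑ j, ⟪Rℓ s x j, FunctionSpaces.Torus.partialDeriv j (vℓ s) x⟫_ℝ) -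
        2 * ν * ((∫ x, ⟪Torus.fracLaplacian γ (v i s) x, v i s x⟫_ℝ) - ∫ x, ⟪Torus.fracLaplacian γ (vℓ s) x, vℓ s x⟫_ℝ) := by
      simp only [hF', h0]
      ring
    rw [e, Real.norm_eq_abs]
    have h1' : |(-2 : ℝ) * ∫ x, ∑ j, ⟪Rℓ s x j, FunctionSpaces.Torus.partialDeriv j (vℓ s) x⟫_ℝ| ≤ 6 * BR * Bv := by
      calc _ ≤ _ := h1
        _ = 6 * BR * Bv := by push_cast; ring
    have h2' : |2 * ν * ((∫ x, ⟪Torus.fracLaplacian γ (v i s) x, v i s x⟫_ℝ) - ∫ x, ⟪Torus.fracLaplacian γ (vℓ s) x, vℓ s x⟫_ℝ)| ≤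
        2 * |ν| * K := by
      rw [abs_mul, abs_mul, abs_two]
      exact mul_le_mul_of_nonneg_left h2 (by positivity)
    calc _ ≤ |-((-2 : ℝ) * ∫ x, ∑ j, ⟪Rℓ s x j, FunctionSpaces.Torus.partialDeriv j (vℓ s) x⟫_ℝ)| +
          |2 * ν * ((∫ x, ⟪Torus.fracLaplacian γ (v i s) x, v i s x⟫_ℝ) - ∫ x, ⟪Torus.fracLaplacian γ (vℓ s) x, vℓ s x⟫_ℝ)| :=
          abs_sub _ _
      _ ≤ 6 * BR * Bv + 2 * |ν| * K := by rw [abs_neg]; exact add_le_add h1' h2'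
  have key := Convex.norm_image_sub_le_of_norm_hasDerivWithin_le hderiv hbound (convex_Icc a' b') hanchor ht'
  have hF0 : F a' = 0 := by
    simp only [hF, ha', h.anchor i hiT, sub_self]
  rw [hF0, sub_zero, Real.norm_eq_abs, Real.norm_eq_abs] at key
  have hdist : |t - a'| ≤ 2 * τ := by
    rw [abs_of_nonneg (sub_nonneg.2 ht'.1)]
    have h1 : t ≤ (i : ℝ) * τ + τ := (ht'.2.trans (min_le_left _ _))
    have h2 : (i : ℝ) * τ - τ ≤ a' := le_max_left _ _
    linarith
  have hC : 0 ≤ 6 * BR * Bv + 2 * |ν| * K := by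
    have := hbound t ht'
    exact (norm_nonneg _).trans this
  calc |F t| ≤ (6 * BR * Bv + 2 * |ν| * K) * |t - a'| := key
    _ ≤ (6 * BR * Bv + 2 * |ν| * K) * (2 * τ) := mul_le_mul_of_nonneg_left hdist hC

/-- **The dissipative difference along the family, from Hölder data**: if `C` is a constant of
`Torus.exists_abs_dissipation_sub_le_of_holder` (exponents `γ < θ ≤ 1`), every slice `v_ℓ(s)` is
`θ`-Hölder with constant `C_H` (quotient metric) and `uᵢ - v_ℓ` obeys the lifted `θ`-Hölder bound
with constant `B ≥ 0` on `Sᵢ`, then on `Sᵢ`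
`|∫⟪(-Δ)^γuᵢ, uᵢ⟫ - ∫⟪(-Δ)^γv_ℓ, v_ℓ⟫| ≤ C (2C_H + B) B` (`uᵢ + v_ℓ = 2v_ℓ + (uᵢ - v_ℓ)`; De Rosa:
"since `‖v_q‖_γ' ≤ 1` … `≲ ‖vᵢ - v_ℓ‖_{γ+α}`"). [cite: Derosa2018, §5.2 Prop. 5.5 (proof of (5.18))] -/
theorem IsGlueFamily.dissipation_sub_le {τ : ℝ} (h : IsGlueFamily γ ν T τ n vℓ pℓ Rℓ v p) {θ : ℝ≥0} {C : ℝ}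
    (hC : ∀ {a b : UnitAddTorus (Fin 3) → EuclideanSpace ℝ (Fin 3)}, FunctionSpaces.Torus.IsSmooth a → FunctionSpaces.Torus.IsSmooth b →
      ∀ {A : ℝ}, 0 ≤ A →
        (∀ y z : EuclideanSpace ℝ (Fin 3), ‖(a (proj y) + b (proj y)) - (a (proj z) + b (proj z))‖ ≤ A * ‖y - z‖ ^ (θ : ℝ)) →
        ∀ {B : ℝ}, 0 ≤ B →
          (∀ y z : EuclideanSpace ℝ (Fin 3), ‖(a (proj y) - b (proj y)) - (a (proj z) - b (proj z))‖ ≤ B * ‖y - z‖ ^ (θ : ℝ)) →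
          |(∫ x, ⟪Torus.fracLaplacian γ a x, a x⟫_ℝ) - ∫ x, ⟪Torus.fracLaplacian γ b x, b x⟫_ℝ| ≤ C * A * B)
    {CH : ℝ≥0} (hH : ∀ s ∈ Icc 0 T, HolderWith CH θ (vℓ s)) {i : ℕ} (hi : i ≤ n) {B : ℝ} (hB : 0 ≤ B)
    (hBi : ∀ s ∈ glueInterval T τ i, ∀ y z : EuclideanSpace ℝ (Fin 3),
      ‖(v i s (proj y) - vℓ s (proj y)) - (v i s (proj z) - vℓ s (proj z))‖ ≤ B * ‖y - z‖ ^ (θ : ℝ))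
    {s : ℝ} (hs : s ∈ glueInterval T τ i) :
    |(∫ x, ⟪Torus.fracLaplacian γ (v i s) x, v i s x⟫_ℝ) - ∫ x, ⟪Torus.fracLaplacian γ (vℓ s) x, vℓ s x⟫_ℝ| ≤
      C * (2 * CH + B) * B := by
  have hsT : s ∈ Icc 0 T := glueInterval_subset_Icc T τ i hs
  have ha : FunctionSpaces.Torus.IsSmooth (v i s) := h.isSmooth_v hi hs
  have hb : FunctionSpaces.Torus.IsSmooth (vℓ s) := h.isSmooth_vℓ hsT
  have hA0 : 0 ≤ 2 * (CH : ℝ) + B := by positivity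
  refine hC ha hb hA0 (fun y z => ?_) hB (hBi s hs)
  have h1 := Torus.holder_lift_of_holderWith (hH s hsT) y z
  have h2 := hBi s hs y z
  calc ‖(v i s (proj y) + vℓ s (proj y)) - (v i s (proj z) + vℓ s (proj z))‖
      = ‖(2 : ℝ) • (vℓ s (proj y) - vℓ s (proj z)) +
          ((v i s (proj y) - vℓ s (proj y)) - (v i s (proj z) - vℓ s (proj z)))‖ := by
        congr 1
        simp only [two_smul]
        abel
    _ ≤ ‖(2 : ℝ) • (vℓ s (proj y) - vℓ s (proj z))‖ +
          ‖(v i s (proj y) - vℓ s (proj y)) - (v i s (proj z) - vℓ s (proj z))‖ := norm_add_le _ _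
    _ ≤ 2 * (CH * ‖y - z‖ ^ (θ : ℝ)) + B * ‖y - z‖ ^ (θ : ℝ) := by
        refine add_le_add ?_ h2
        rw [norm_smul, Real.norm_two]
        exact mul_le_mul_of_nonneg_left h1 zero_le_two
    _ = (2 * CH + B) * ‖y - z‖ ^ (θ : ℝ) := by ring

/-- **The lifted Hölder bound on `uᵢ - v_ℓ` from the stability bounds** ((5.10) at orders `0, 1`,
interpolated, BDSV (A.3)): if `‖uᵢ - v_ℓ‖_{N+α} ≤ C₃ τ_q δ_{q+1} ℓ^{-N-1+α}` on `Sᵢ` for `N ≤ N̄`,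
`1 ≤ N̄`, then for `θ ∈ [0,1]`, on `Sᵢ`,
`‖(uᵢ - v_ℓ)(proj y) - (uᵢ - v_ℓ)(proj z)‖ ≤ 3|C₃| τ_q δ_{q+1} ℓ^{-1-θ+α} ‖y - z‖^θ`
(De Rosa: "`‖vᵢ - v_ℓ‖_{γ+α} ≲ τ_qδ_{q+1}ℓ^{-1-γ}`"). [cite: Derosa2018, §5.2 Prop. 5.5 (proof of (5.18))] -/
theorem IsGlueFamily.holder_lift_velocity_sub (h : IsGlueFamily γ ν T (glueScale β α a b q) n vℓ pℓ Rℓ v p)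
    (hS : ∀ i : ℕ, i ≤ n → StabilityBounds β α a b T C₃ q Nb i vℓ pℓ (v i) (p i)) (hNb : 1 ≤ Nb)
    (ha : 1 ≤ a) {θ : ℝ} (hθ0 : 0 ≤ θ) (hθ1 : θ ≤ 1) {i : ℕ} (hi : i ≤ n) {s : ℝ}
    (hs : s ∈ glueInterval T (glueScale β α a b q) i) (y z : EuclideanSpace ℝ (Fin 3)) :
    ‖(v i s (proj y) - vℓ s (proj y)) - (v i s (proj z) - vℓ s (proj z))‖ ≤
      3 * |C₃| * (glueScale β α a b q * amp β a b (q + 1) * mollScale β α a b q ^ (-1 - θ + α)) *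
        ‖y - z‖ ^ θ := by
  set τ := glueScale β α a b q with hτdef
  set ℓ := mollScale β α a b q with hℓdef
  set δ := amp β a b (q + 1) with hδdef
  have hτ : 0 < τ := h.hτ
  have hℓ : 0 < ℓ := mollScale_pos ha q
  have hδ : 0 < δ := amp_pos ha (q + 1)
  have hsT : s ∈ Icc 0 T := glueInterval_subset_Icc T τ i hs
  set w : UnitAddTorus (Fin 3) → EuclideanSpace ℝ (Fin 3) := fun x => v i s x - vℓ s x with hw
  have hws : FunctionSpaces.Torus.IsSmooth w := (h.isSmooth_v hi hs).sub (h.isSmooth_vℓ hsT)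
  -- the two stability bounds
  set P : ℝ := |C₃| * (τ * δ * ℓ ^ (-1 + α)) with hP
  have hP0 : 0 ≤ P := by positivity
  have h0 := (hS i hi).velocity_sub 0 (Nat.zero_le _) s hs
  have h1 := (hS i hi).velocity_sub 1 hNb s hs
  simp only [Nat.cast_zero, neg_zero, zero_sub] at h0
  simp only [Nat.cast_one] at h1
  have hX0 : ∀ x, ‖w x‖ ≤ P := by
    intro x
    have hx := norm_le_max_of_eContDiffHolderNorm_le h0 x
    refine hx.trans (max_le ?_ hP0)
    exact mul_le_mul_of_nonneg_right (le_abs_self _) (by positivity)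
  have hX1 : ∀ j x, ‖FunctionSpaces.Torus.partialDeriv j w x‖ ≤ P * ℓ ^ (-1 : ℝ) := by
    intro j x
    have hx := norm_partialDeriv_le_max_of_eContDiffHolderNorm_le hws h1 j x
    refine hx.trans (max_le ?_ (by positivity))
    have e : τ * δ * ℓ ^ (-1 - 1 + α) = τ * δ * ℓ ^ (-1 + α) * ℓ ^ (-1 : ℝ) := by
      rw [show (-1 - 1 + α : ℝ) = (-1 + α) + (-1) by ring, Real.rpow_add hℓ (-1 + α) (-1)]
      ring
    rw [e]
    calc C₃ * (τ * δ * ℓ ^ (-1 + α) * ℓ ^ (-1 : ℝ)) ≤ |C₃| * (τ * δ * ℓ ^ (-1 + α) * ℓ ^ (-1 : ℝ)) :=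
          mul_le_mul_of_nonneg_right (le_abs_self _) (by positivity)
      _ = P * ℓ ^ (-1 : ℝ) := by rw [hP]; ring
  have key := Torus.holder_lift_interpolate (hws.isContDiff (by simp)) (by positivity) hX0 hX1 hθ0 hθ1 y z
  rw [Fintype.card_fin] at key
  refine key.trans (mul_le_mul_of_nonneg_right ?_ (Real.rpow_nonneg (norm_nonneg _) _))
  -- `(2P)^{1-θ} (3Pℓ⁻¹)^θ ≤ (3P)^{1-θ} (3P)^θ ℓ^{-θ} = 3 P ℓ^{-θ}`
  have hℓinv : 0 ≤ ℓ ^ (-1 : ℝ) := Real.rpow_nonneg hℓ.le _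
  have h3P : 0 ≤ 3 * P := by positivity
  have hℓθ : (ℓ ^ (-1 : ℝ)) ^ θ = ℓ ^ (-θ) := by rw [← Real.rpow_mul hℓ.le]; simp
  have step1 : (2 * P) ^ (1 - θ) ≤ (3 * P) ^ (1 - θ) :=
    Real.rpow_le_rpow (by positivity) (by linarith) (by linarith)
  have step2 : (((3 : ℕ) : ℝ) * (P * ℓ ^ (-1 : ℝ))) ^ θ = (3 * P) ^ θ * ℓ ^ (-θ) := by
    rw [show ((3 : ℕ) : ℝ) * (P * ℓ ^ (-1 : ℝ)) = (3 * P) * ℓ ^ (-1 : ℝ) by push_cast; ring,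
      Real.mul_rpow (x := 3 * P) (y := ℓ ^ (-1 : ℝ)) h3P hℓinv, hℓθ]
  have step3 : (3 * P) ^ (1 - θ) * (3 * P) ^ θ = 3 * P := by
    rcases eq_or_lt_of_le h3P with h0' | hpos
    · rw [← h0']
      rcases eq_or_lt_of_le hθ0 with hθ00 | hθpos
      · rw [← hθ00]; simp
      · rw [Real.zero_rpow hθpos.ne']; simp
    · rw [← Real.rpow_add hpos]; simp
  have e4 : ℓ ^ (-1 + α) * ℓ ^ (-θ) = ℓ ^ (-1 - θ + α) := by
    rw [← Real.rpow_add hℓ]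
    congr 1
    ring
  calc (2 * P) ^ (1 - θ) * (((3 : ℕ) : ℝ) * (P * ℓ ^ (-1 : ℝ))) ^ θ
      ≤ (3 * P) ^ (1 - θ) * (((3 : ℕ) : ℝ) * (P * ℓ ^ (-1 : ℝ))) ^ θ :=
        mul_le_mul_of_nonneg_right step1 (Real.rpow_nonneg (by positivity) _)
    _ = ((3 * P) ^ (1 - θ) * (3 * P) ^ θ) * ℓ ^ (-θ) := by rw [step2]; ring
    _ = 3 * P * ℓ ^ (-θ) := by rw [step3]
    _ = 3 * |C₃| * (τ * δ * (ℓ ^ (-1 + α) * ℓ ^ (-θ))) := by rw [hP]; ring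
    _ = 3 * |C₃| * (τ * δ * ℓ ^ (-1 - θ + α)) := by rw [e4]

/-- **(5.18) for the glued velocity**: for the glued triple of a `DeRosa.IsGlueFamily` with the
stability bounds (5.10) (constant `C₃`), the inductive bounds (5.6)₀ on `v_ℓ`, (5.7′)₀ on `R̊_ℓ`
(constants `C_in`), and a bound `K` for the dissipative differences
`|∫⟪(-Δ)^γuᵢ, uᵢ⟫ - ∫⟪(-Δ)^γv_ℓ, v_ℓ⟫|` on the life spans,
`|∫|v̄(t)|² - ∫|v_ℓ(t)|²| ≤ (12 C_in(0)² + 4 C₃²) δ_{q+1} ℓ^α + 4|ν| K τ_q` for every `t ∈ [0,T]`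
(`|v̄|² = θ|uᵢ|² + (1-θ)|uᵢ'|² - θ(1-θ)|uᵢ - uᵢ'|²`; the first two energies are within
`(6·C_in(0)²δ_{q+1}ℓ^αℓ^{2α}τ_q⁻¹ + 2|ν|K)·2τ_q` of `∫|v_ℓ|²` by `abs_energy_v_sub_le` and
`τ_qδ_q^{1/2}λ_q = ℓ^{2α}`, and `|uᵢ - uᵢ'| ≤ 2|C₃|τ_qδ_{q+1}ℓ^{-1+α} ≤ 2|C₃|δ_{q+1}^{1/2}ℓ^α`).
[cite: Derosa2018, §5.2 Prop. 5.5 (5.18)] -/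
theorem IsGlueFamily.abs_energy_gluedVel_sub_le (h : IsGlueFamily γ ν T (glueScale β α a b q) n vℓ pℓ Rℓ v p)
    (hS : ∀ i : ℕ, i ≤ n → StabilityBounds β α a b T C₃ q Nb i vℓ pℓ (v i) (p i)) (ha : 1 ≤ a)
    (hb : 1 ≤ b) (hβ : 0 ≤ β) (hα : 0 ≤ α)
    (h213 : ∀ N : ℕ, HolderSupLE T vℓ (N + 1) 0
      (Cin N * (Real.sqrt (amp β a b q) * freq a b q * mollScale β α a b q ^ (-(N : ℝ)))))
    (h214 : ∀ N : ℕ, HolderSupLE T Rℓ N (Real.toNNReal α)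
      (Cin N * (amp β a b (q + 1) * mollScale β α a b q ^ (-(N : ℝ) + α))))
    {K : ℝ}
    (hKb : ∀ i : ℕ, i ≤ n → ∀ s ∈ glueInterval T (glueScale β α a b q) i,
      |(∫ x, ⟪Torus.fracLaplacian γ (v i s) x, v i s x⟫_ℝ) - ∫ x, ⟪Torus.fracLaplacian γ (vℓ s) x, vℓ s x⟫_ℝ| ≤ K)
    {t : ℝ} (htT : t ∈ Icc 0 T) :
    |(∫ x, ‖gluedVel (glueScale β α a b q) n v t x‖ ^ 2) - ∫ x, ‖vℓ t x‖ ^ 2| ≤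
      (12 * Cin 0 ^ 2 + 4 * C₃ ^ 2) * (amp β a b (q + 1) * mollScale β α a b q ^ α) +
        4 * |ν| * K * glueScale β α a b q := by
  set τ := glueScale β α a b q with hτdef
  set ℓ := mollScale β α a b q with hℓdef
  set δ := amp β a b (q + 1) with hδdef
  set A := Real.sqrt (amp β a b q) * freq a b q with hAdef
  have hτ : 0 < τ := h.hτ
  have hℓ : 0 < ℓ := mollScale_pos ha q
  have hℓ1 : ℓ ≤ 1 := mollScale_le_one ha hb hβ hα q
  have hδ : 0 < δ := amp_pos ha (q + 1)
  have hA : 0 < A := mul_pos (Real.sqrt_pos.2 (amp_pos ha q)) (freq_pos ha q)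
  have hℓα : 0 < ℓ ^ α := Real.rpow_pos_of_pos hℓ α
  -- the sup bounds on `R̊_ℓ` and `∇v_ℓ`
  set BR := |Cin 0| * (δ * ℓ ^ α) with hBR
  set Bv := |Cin 0| * A with hBv
  have hBR0 : 0 ≤ BR := by positivity
  have hBv0 : 0 ≤ Bv := by positivity
  have hR : ∀ s ∈ Icc 0 T, ∀ x j, ‖Rℓ s x j‖ ≤ BR := by
    intro s hs x j
    have h0 := h214 0 s hs
    simp only [Nat.cast_zero, neg_zero, zero_add] at h0
    have hx := norm_le_max_of_eContDiffHolderNorm_le h0 x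
    refine (norm_le_pi_norm (Rℓ s x) j).trans (hx.trans (max_le ?_ hBR0))
    exact mul_le_mul_of_nonneg_right (le_abs_self _) (by positivity)
  have hDv : ∀ s ∈ Icc 0 T, ∀ x j, ‖FunctionSpaces.Torus.partialDeriv j (vℓ s) x‖ ≤ Bv := by
    intro s hs x j
    have h0 := h213 0 s hs
    simp only [Nat.cast_zero, neg_zero, Real.rpow_zero, mul_one, zero_add] at h0
    have hx := norm_partialDeriv_le_max_of_eContDiffHolderNorm_le (h.isSmooth_vℓ hs) h0 j x
    refine hx.trans (max_le ?_ hBv0)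
    exact mul_le_mul_of_nonneg_right (le_abs_self _) hA.le
  -- `6 B_R B_v · 2τ = 12 Cin₀² δ ℓ^α ℓ^{2α} ≤ 12 Cin₀² δ ℓ^α`
  have hK1 : 6 * BR * Bv * (2 * τ) ≤ 12 * Cin 0 ^ 2 * (δ * ℓ ^ α) := by
    have hsq : |Cin 0| * |Cin 0| = Cin 0 ^ 2 := by rw [← sq, sq_abs]
    have e : 6 * BR * Bv * (2 * τ) = 12 * Cin 0 ^ 2 * (δ * ℓ ^ α) * (τ * A) := by
      rw [← hsq]
      simp only [hBR, hBv]
      ring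
    rw [e, hAdef, hτdef, glueScale_mul_sqrt_amp_mul_freq ha q]
    refine mul_le_of_le_one_right (by positivity) ?_
    exact Real.rpow_le_one hℓ.le hℓ1 (by linarith)
  have hKK : ∀ {i : ℕ} (hi : i ≤ n) {s : ℝ} (hs : s ∈ glueInterval T τ i),
      |(∫ x, ‖v i s x‖ ^ 2) - ∫ x, ‖vℓ s x‖ ^ 2| ≤ 12 * Cin 0 ^ 2 * (δ * ℓ ^ α) + 4 * |ν| * K * τ := by
    intro i hi s hs
    have h1 := h.abs_energy_v_sub_le hi hBR0 hR hDv (hKb i hi) hs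
    have e : (6 * BR * Bv + 2 * |ν| * K) * (2 * τ) = 6 * BR * Bv * (2 * τ) + 4 * |ν| * K * τ := by ring
    rw [e] at h1
    linarith
  -- the decomposition of `v̄(t)`
  obtain ⟨i, i', θ, hi, hi', hθ, hti, hti', hdec⟩ := h.exists_convex_decomp htT
  have hu : FunctionSpaces.Torus.IsSmooth (v i t) := h.isSmooth_v hi hti
  have hw : FunctionSpaces.Torus.IsSmooth (v i' t) := h.isSmooth_v hi' hti'
  have hvℓt : FunctionSpaces.Torus.IsSmooth (vℓ t) := h.isSmooth_vℓ htT
  -- energies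
  set Eu := ∫ x, ‖v i t x‖ ^ 2 with hEu
  set Ew := ∫ x, ‖v i' t x‖ ^ 2 with hEw
  set Eℓ := ∫ x, ‖vℓ t x‖ ^ 2 with hEℓ
  set D := ∫ x, ‖v i t x - v i' t x‖ ^ 2 with hD
  have hEbar : (∫ x, ‖gluedVel τ n v t x‖ ^ 2) = θ * Eu + (1 - θ) * Ew - θ * (1 - θ) * D := by
    have hpt : ∀ x, ‖gluedVel τ n v t x‖ ^ 2 =
        θ * ‖v i t x‖ ^ 2 + (1 - θ) * ‖v i' t x‖ ^ 2 - θ * (1 - θ) * ‖v i t x - v i' t x‖ ^ 2 := by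
      intro x; rw [hdec x, norm_sq_convex_comb]
    simp_rw [hpt]
    have i1 : Integrable (fun x => θ * ‖v i t x‖ ^ 2) volume := hu.norm_sq.integrable.const_mul θ
    have i2 : Integrable (fun x => (1 - θ) * ‖v i' t x‖ ^ 2) volume := hw.norm_sq.integrable.const_mul _
    have i3 : Integrable (fun x => θ * (1 - θ) * ‖v i t x - v i' t x‖ ^ 2) volume :=
      (hu.sub hw).norm_sq.integrable.const_mul _
    have i12 : Integrable (fun x => θ * ‖v i t x‖ ^ 2 + (1 - θ) * ‖v i' t x‖ ^ 2) volume := i1.add i2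
    rw [integral_sub i12 i3, integral_add i1 i2, integral_const_mul, integral_const_mul,
      integral_const_mul]
  -- the two energy differences
  set G : ℝ := 12 * Cin 0 ^ 2 * (δ * ℓ ^ α) + 4 * |ν| * K * τ with hG
  have hEuℓ : |Eu - Eℓ| ≤ G := hKK hi hti
  have hEwℓ : |Ew - Eℓ| ≤ G := hKK hi' hti'
  -- the interaction term: `|uᵢ - uᵢ'| ≤ 2|C₃| δ^{1/2} ℓ^α` pointwise
  have hX0 : 0 ≤ τ * δ * ℓ ^ (-1 + α) := by positivity
  have hpoint : ∀ x, ‖v i t x - v i' t x‖ ≤ 2 * |C₃| * (Real.sqrt δ * ℓ ^ α) := by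
    intro x
    have h46 : τ * δ * ℓ ^ (-1 + α) ≤ Real.sqrt δ * ℓ ^ α :=
      glueScale_mul_amp_succ_mul_rpow_le_sqrt ha hb hβ hα q
    have hb1 : ∀ {k : ℕ} (hk : k ≤ n) (htk : t ∈ glueInterval T τ k),
        ‖v k t x - vℓ t x‖ ≤ |C₃| * (Real.sqrt δ * ℓ ^ α) := by
      intro k hk htk
      have hvs := (hS k hk).velocity_sub 0 (Nat.zero_le _) t htk
      simp only [Nat.cast_zero, neg_zero, zero_sub] at hvs
      have hx := norm_le_max_of_eContDiffHolderNorm_le hvs x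
      refine hx.trans (max_le ?_ (by positivity))
      calc C₃ * (τ * δ * ℓ ^ (-1 + α)) ≤ |C₃| * (τ * δ * ℓ ^ (-1 + α)) :=
            mul_le_mul_of_nonneg_right (le_abs_self _) hX0
        _ ≤ |C₃| * (Real.sqrt δ * ℓ ^ α) := mul_le_mul_of_nonneg_left h46 (abs_nonneg _)
    calc ‖v i t x - v i' t x‖ = ‖(v i t x - vℓ t x) - (v i' t x - vℓ t x)‖ := by congr 1; abel
      _ ≤ ‖v i t x - vℓ t x‖ + ‖v i' t x - vℓ t x‖ := norm_sub_le _ _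
      _ ≤ |C₃| * (Real.sqrt δ * ℓ ^ α) + |C₃| * (Real.sqrt δ * ℓ ^ α) := add_le_add (hb1 hi hti) (hb1 hi' hti')
      _ = 2 * |C₃| * (Real.sqrt δ * ℓ ^ α) := by ring
  have hDle : D ≤ 4 * C₃ ^ 2 * (δ * ℓ ^ α) := by
    have hsq : ∀ x, ‖v i t x - v i' t x‖ ^ 2 ≤ (2 * |C₃| * (Real.sqrt δ * ℓ ^ α)) ^ 2 := fun x =>
      pow_le_pow_left₀ (norm_nonneg _) (hpoint x) 2
    have hℓ2α : (ℓ ^ α) ^ 2 ≤ ℓ ^ α := by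
      rw [sq]
      exact mul_le_of_le_one_left hℓα.le (Real.rpow_le_one hℓ.le hℓ1 hα)
    calc D ≤ ∫ _x : UnitAddTorus (Fin 3), (2 * |C₃| * (Real.sqrt δ * ℓ ^ α)) ^ 2 :=
          integral_mono_of_nonneg (Eventually.of_forall fun x => by positivity) (integrable_const _)
            (Eventually.of_forall hsq)
      _ = (2 * |C₃| * (Real.sqrt δ * ℓ ^ α)) ^ 2 := by simp
      _ = 4 * C₃ ^ 2 * (δ * (ℓ ^ α) ^ 2) := by
          rw [mul_pow, mul_pow, mul_pow, sq_abs, Real.sq_sqrt hδ.le]; ring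
      _ ≤ 4 * C₃ ^ 2 * (δ * ℓ ^ α) := by gcongr
  have hD0 : 0 ≤ D := integral_nonneg fun x => by positivity
  have hθ1 : 0 ≤ 1 - θ := sub_nonneg.2 hθ.2
  have hθθ : θ * (1 - θ) ≤ 1 := by nlinarith [hθ.1, hθ.2]
  -- assemble
  have hrw : (∫ x, ‖gluedVel τ n v t x‖ ^ 2) - Eℓ =
      θ * (Eu - Eℓ) + (1 - θ) * (Ew - Eℓ) - θ * (1 - θ) * D := by rw [hEbar]; ring
  have hGoal : (12 * Cin 0 ^ 2 + 4 * C₃ ^ 2) * (δ * ℓ ^ α) + 4 * |ν| * K * τ = G + 4 * C₃ ^ 2 * (δ * ℓ ^ α) := by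
    rw [hG]; ring
  rw [hrw, hGoal, abs_le]
  obtain ⟨e1l, e1u⟩ := abs_le.1 hEuℓ
  obtain ⟨e2l, e2u⟩ := abs_le.1 hEwℓ
  have e1l' : θ * (-G) ≤ θ * (Eu - Eℓ) := mul_le_mul_of_nonneg_left e1l hθ.1
  have e1u' : θ * (Eu - Eℓ) ≤ θ * G := mul_le_mul_of_nonneg_left e1u hθ.1
  have e2l' : (1 - θ) * (-G) ≤ (1 - θ) * (Ew - Eℓ) := mul_le_mul_of_nonneg_left e2l hθ1
  have e2u' : (1 - θ) * (Ew - Eℓ) ≤ (1 - θ) * G := mul_le_mul_of_nonneg_left e2u hθ1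
  have e3l : 0 ≤ θ * (1 - θ) * D := mul_nonneg (mul_nonneg hθ.1 hθ1) hD0
  have e3u : θ * (1 - θ) * D ≤ 4 * C₃ ^ 2 * (δ * ℓ ^ α) :=
    ((mul_le_mul_of_nonneg_right hθθ hD0).trans_eq (one_mul D)).trans hDle
  have hK0 : 0 ≤ 4 * C₃ ^ 2 * (δ * ℓ ^ α) := by positivity
  constructor <;> linarith [e1l', e1u', e2l', e2u', e3l, e3u, hK0]

end Energy

end DeRosa

end Literature.Analysis.FluidPDE
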